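import Summits.AnomalousDissipation.AnomalousDissipation.Theses.HopfSnake
import Literature.Analysis.FluidPDE.DoeringFoias

/-!
# Line `df-power` for the crux `SnakesSaturateDoeringFoias3D` (stmt-AnomalousDissipation-17647; piece 2 of the
typed decomposition of `BoundedLoudSnake`, stmt-AnomalousDissipation-1802, route HopfSnake)

Skeleton (crux-strategist, 2026-08-17): the dimensionless dissipation law along bounded snakes of genuinely
three-dimensional forces, `ε(s) ≥ β U(s)³` cofinally as `ν(s) → 0`, from

* `stub_powerLaw` (load-bearing, conjecture-grade, GRADIENT-FREE): the mean injected power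
  `⟨∫ f·u(s)⟩ = meanPower f (u s)` — the work of the fixed force on the period-averaged flow — is `≥ β U(s)³`
  cofinally: a statement about the first moment of the velocity against `f` and the second moment only;
* `stub_meanPower_le_meanDissipation` (analytic, ROUTINE — S/M-sized corollary of a LANDED theorem): along a
  time-periodic classical solution of `NS_ν(f)` the limsup-mean injected power is at most (in fact equal to) the
  limsup-mean dissipation: restrict the global solution to `[0, ∞)` (`Torus.IsClassicalNSSolutionOn.mono`), bound
  `∫‖u(t)‖²` pointwise by periodicity + continuity, and apply the landed
  `Theorems.ChainRealisation.SeparatrixFluxPinning.meanDissipation_eq_longTimeAvgSup_inner` (energy equality on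
  `[0, T]`, boundary term `(E(0) − E(T))/T → 0`); kept as a stub only so that the line's two obligations are
  explicit — the load is entirely on stub 1;

composed in `SnakesSaturateDoeringFoias3D_proof` (instantiate the power law on the snake, chain the two inequalities
member by member).  Honours the Doering–Foias seam of the parent split: nothing here bounds `U` from below (that is
the PROVED glue `BoundedLoudSnakeOfPieces`), and nothing assumes a dissipation floor.
-/

namespace Summit.AnomalousDissipation.AnomalousDissipation.Cruxes.BoundedLoudSnake.DfPower

/-- STUB 1 — THE POWER LAW (load-bearing): along every bounded (d)-snake of a genuinely three-dimensional smooth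
steady divergence-free mean-zero force, the mean injected power `⟨∫ f·u(s)⟩` is at least `β U(s)³` at arbitrarily
small `ν(s)` (`U(s) = ⟨‖u(s)‖₂²⟩^{1/2}`).  Gradient-free form of Kolmogorov's law `C_ε > 0` for these exact
solutions (for classical periodic orbits `⟨f·u⟩ = ε`).  Why it might fail: the mean flow may decorrelate from `f`
(planar mechanism, Alexakis–Doering) along near-planar 3-D forces. -/
theorem stub_powerLaw :
    ∀ f : UnitAddTorus (Fin 3) → EuclideanSpace ℝ (Fin 3), Literature.Analysis.FunctionSpaces.Torus.IsSmooth f → Literature.Analysis.FunctionSpaces.Torus.IsDivFree f → Literature.Analysis.FunctionSpaces.Torus.HasZeroMean f → (∀ k : EuclideanSpace ℝ (Fin 3), k ≠ 0 → ∃ τ : ℝ, ∃ x, f (x + Literature.Analysis.FunctionSpaces.Torus.proj (τ • k)) ≠ f x) → ∀ (ν : ℝ → ℝ) (u : ℝ → ℝ → UnitAddTorus (Fin 3) → EuclideanSpace ℝ (Fin 3)) (p : ℝ → ℝ → UnitAddTorus (Fin 3) → ℝ), (Continuous ν ∧ Continuous (fun q : ℝ × ℝ × UnitAddTorus (Fin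 3) => u q.1 q.2.1 q.2.2) ∧ (∀ s, 0 < ν s ∧ Literature.Analysis.FunctionSpaces.Torus.IsClassicalNSSolutionOn Set.univ (ν s) (fun _ => f) (u s) (p s) ∧ (∀ t, Literature.Analysis.FunctionSpaces.Torus.HasZeroMean (u s t)) ∧ (∃ T, 0 < T ∧ Function.Periodic (u s) T) ∧ (∃ t, Literature.Analysis.FunctionSpaces.Torus.kineticEnergy (u s t) ≠ Literature.Analysis.FunctionSpaces.Torus.kineticEnergy (u s 0))) ∧ (∀ ν₀, 0 < ν₀ → ∃ s, ν s < ν₀) ∧ (∀ ν₁, 0 < ν₁ → ∃ M, ∀ s, ν₁ ≤ ν s → (∃ T, 0 < T ∧ T ≤ M ∧ Function.Periodic (u s) T) ∧ ∀ t, Literature.Analysis.FunctionSpaces.Torus.gradNormSq (u s t) ≤ M)) → (∃ E : ℝ, ∀ s, Literature.Analysis.FluidPDE.meanEnergy (u s) ≤ E) → ∃ β : ℝ, 0 < β ∧ ∀ ν₀, 0 < ν₀ → ∃ s, ν s < ν₀ ∧ β * Literature.Analysis.FluidPDE.rmsVelocity Literature.Analysis.FluidPDE.longTimeAvgSup (u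 s) ^ 3 ≤ Literature.Analysis.FluidPDE.meanPower f (u s) := by
  sorry

/-- STUB 2 — POWER ≤ DISSIPATION ALONG PERIODIC CLASSICAL ORBITS (routine corollary of the landed
`Theorems.ChainRealisation.SeparatrixFluxPinning.meanDissipation_eq_longTimeAvgSup_inner` via
`Torus.IsClassicalNSSolutionOn.mono` to `[0, ∞)` and boundedness of `t ↦ ∫‖u(t)‖²` along a continuous periodic
orbit): for `ν > 0`, a classical solution `(u, p)` of `NS_ν` on `ℝ × T³` with steady force `f`, time-periodic with
some period `T > 0`, has `meanPower f u ≤ meanDissipation ν u`. -/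
theorem stub_meanPower_le_meanDissipation :
    ∀ (ν : ℝ) (f : UnitAddTorus (Fin 3) → EuclideanSpace ℝ (Fin 3)) (u : ℝ → UnitAddTorus (Fin 3) → EuclideanSpace ℝ (Fin 3)) (p : ℝ → UnitAddTorus (Fin 3) → ℝ), 0 < ν → Literature.Analysis.FunctionSpaces.Torus.IsClassicalNSSolutionOn Set.univ ν (fun _ => f) u p → (∃ T, 0 < T ∧ Function.Periodic u T) → Literature.Analysis.FluidPDE.meanPower f u ≤ Literature.Analysis.FluidPDE.meanDissipation ν u := by
  sorry

/-- COMPOSITION (kernel-checked, no sorry of its own): the two stubs give the crux `SnakesSaturateDoeringFoias3D`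
BY NAME — instantiate the power law on the given snake and chain `β U(s)³ ≤ ⟨f·u(s)⟩ ≤ ε(s)` member by member
(each member is a periodic classical solution at positive viscosity by the snake clause). -/
theorem SnakesSaturateDoeringFoias3D_proof :
    Summit.AnomalousDissipation.AnomalousDissipation.Theses.HopfSnake.SnakesSaturateDoeringFoias3D := by
  intro f hf hdiv hmean h3d ν u p hsnake hE
  obtain ⟨β, hβ, hlaw⟩ := stub_powerLaw f hf hdiv hmean h3d ν u p hsnake hE
  refine ⟨β, hβ, fun ν₀ hν₀ => ?_⟩
  obtain ⟨s, hs, hβs⟩ := hlaw ν₀ hν₀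
  have hsol := hsnake.2.2.1 s
  exact ⟨s, hs, hβs.trans
    (stub_meanPower_le_meanDissipation (ν s) f (u s) (p s) hsol.1 hsol.2.1 hsol.2.2.2.1)⟩

end Summit.AnomalousDissipation.AnomalousDissipation.Cruxes.BoundedLoudSnake.DfPower
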